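import Summits.Parity.GeneralizedHardyLittlewood.Theorems.DilatedTableChowla.Negative.DilatedTableChowlaScale

/-!
# `DilatedTableChowla` (stmt-Parity-14271): `x₀` is not uniform in `δ`; the cheap `δ`-frontier (`δ = 1/2` dies by counting)

Negative lemmas for the crux `LiouvilleShiftedTables.DilatedTableChowla` (route LiouvilleShiftedTables, X1; cdisprove seat), landed verbatim from the crux work file `Cruxes/DilatedTableChowla/Disproof.lean` (§8, §15 there) so that skeletons, ideators and provers can import them.  Notation (`rows`, `cols`, `S`, `F`, `lhs`, `crux_iff_lhs`) from `DilatedTableChowlaBlocks`. [folklore]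
-/

namespace Summit.Parity.GeneralizedHardyLittlewood.Theorems.DilatedTableChowla.Negative

open Summit.Parity.GeneralizedHardyLittlewood.Theses.LiouvilleShiftedTables
open Finset

/-! ## §8 (e) QUANTIFIER ORDER: `x₀` cannot be chosen uniformly in `δ` -/

/-- The crux with `∃ x₀` moved in front of `∀ δ`. -/
def UniformInDelta : Prop :=
  ∀ c : ℤ, c ≠ 0 → ∀ C : ℝ, 0 < C → ∃ x₀ : ℝ, ∀ δ : ℝ, 0 < δ → δ ≤ 1 / 12 → ∀ x : ℝ, x₀ ≤ x →
    ∀ A : ℝ, x ^ δ ≤ A → A ≤ x ^ (1 / 3 + δ) → ∀ u v : ℕ → ℕ,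
      lhs c δ x A u v ≤ x ^ 2 / Real.log x ^ C

/-- (e) `x₀` must depend on `δ`: given `x₀`, take `x = N ≥ max(x₀, 2¹²)` even and `δ = log 2/log N`,
so that `x^δ = 2`, `A = 2` is admissible, the table has the two rows `{3,4}` and `N/2` columns, and
the diagonal `2 (N/2)²` beats `N²/log N` as soon as `log N > 2`. -/
theorem false_uniform_in_delta : ¬ UniformInDelta := by
  intro h
  obtain ⟨x₀, hx₀⟩ := h 1 one_ne_zero 1 one_pos
  obtain ⟨M, hM⟩ := exists_nat_ge (max x₀ (2 ^ 11))
  have hM11 : (2 : ℝ) ^ 11 ≤ M := le_trans (le_max_right _ _) hM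
  have hMx : x₀ ≤ M := le_trans (le_max_left _ _) hM
  set N : ℕ := 2 * M with hN
  have hNM : (N : ℝ) = 2 * M := by rw [hN]; push_cast; ring
  have hN12 : (2 : ℝ) ^ 12 ≤ N := by rw [hNM]; nlinarith
  have hMpos : (0 : ℝ) < M := by nlinarith
  have hNpos : (0 : ℝ) < N := by rw [hNM]; linarith
  have hN1 : (1 : ℝ) ≤ N := by linarith
  have hxN : x₀ ≤ N := by rw [hNM]; linarith
  have hlogN : 12 * Real.log 2 ≤ Real.log N := by
    calc 12 * Real.log 2 = Real.log ((2 : ℝ) ^ 12) := by rw [Real.log_pow]; norm_num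
      _ ≤ Real.log N := Real.log_le_log (by positivity) hN12
  have hlog2 := Real.log_two_gt_d9
  have hlog2pos : 0 < Real.log 2 := by linarith
  have hlogNpos : 0 < Real.log N := by linarith
  set δ : ℝ := Real.log 2 / Real.log N with hδ
  have hδpos : 0 < δ := div_pos hlog2pos hlogNpos
  have hδle : δ ≤ 1 / 12 := by
    rw [hδ, div_le_iff₀ hlogNpos]; linarith
  have hxδ : (N : ℝ) ^ δ = 2 := by
    rw [Real.rpow_def_of_pos hNpos, hδ, mul_div_cancel₀ _ hlogNpos.ne', Real.exp_log two_pos]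
  have hA1 : (N : ℝ) ^ δ ≤ 2 := hxδ.le
  have hA2 : (2 : ℝ) ≤ (N : ℝ) ^ (1 / 3 + δ) := by
    calc (2 : ℝ) = (N : ℝ) ^ δ := hxδ.symm
      _ ≤ (N : ℝ) ^ (1 / 3 + δ) := Real.rpow_le_rpow_of_exponent_le hN1 (by linarith)
  have key := hx₀ δ hδpos hδle N hxN 2 hA1 hA2 (fun _ => 0) (fun _ => 0)
  have hrows : (rows (2 : ℝ) 1 0).card = 2 := by
    rw [rows_one, show (2 : ℝ) * 2 = ((4 : ℕ) : ℝ) by norm_num, Nat.floor_natCast,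
      show (2 : ℝ) = ((2 : ℕ) : ℝ) by norm_num, Nat.floor_natCast, Nat.card_Ioc]
  have hcols : (cols (N : ℝ) 2 1 0).card = M := by
    rw [cols_one, show (N : ℝ) / 2 = (M : ℝ) by rw [hNM]; ring, Nat.floor_natCast, Nat.card_Icc]
    omega
  have hF := rows_mul_cols_sq_le_F (c := 1) (by norm_num) (N : ℝ) 2 1 0 0
  rw [hrows, hcols] at hF
  push_cast at hF
  have h2 : F 1 (N : ℝ) 2 1 0 0 ≤ lhs 1 δ N 2 (fun _ => 0) (fun _ => 0) :=
    F_one_le_lhs 1 hδpos.le hN1 2 (fun _ => 0) (fun _ => 0)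
  -- right-hand side: N²/log N < 2 M² since log N > 2
  have hlogN2 : 2 < Real.log N := by
    rw [Real.lt_log_iff_exp_lt hNpos]
    have he := Real.exp_one_lt_d9
    have : Real.exp 2 = Real.exp 1 * Real.exp 1 := by rw [← Real.exp_add]; norm_num
    rw [this]
    have h8 : (8 : ℝ) ≤ N := le_trans (by norm_num) hN12
    nlinarith [Real.exp_pos 1]
  have hrhs : (N : ℝ) ^ 2 / Real.log N ^ (1 : ℝ) < 2 * (M : ℝ) ^ 2 := by
    have e : (N : ℝ) ^ 2 = 4 * (M : ℝ) ^ 2 := by rw [hNM]; ring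
    rw [Real.rpow_one, div_lt_iff₀ hlogNpos, e]
    have := mul_lt_mul_of_pos_left hlogN2 (show (0 : ℝ) < 2 * (M : ℝ) ^ 2 by positivity)
    linarith
  linarith [key, hF, h2, hrhs]



/-! ## §15 (g) THE CHEAP δ-FRONTIER: with the crux's own dilation range, `δ = 1/2` dies by counting

At `δ = 1/2` the window reaches `A = x^{5/6}`: with `x = N¹²`, `A = N¹⁰`, only `N²` columns but
dilations up to `N³`; for `N² < q ≤ N³` the column class `b ≡ 1 (q)` is the single column `{1}`,
so `F(q,0,1) = #rows² ≥ (N¹⁰/(2q))²` with no cancellation possible, and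
`Σ_{N²<q≤N³} q³ (N¹⁰/(2q))² ≥ N²⁵/8 > x² ≥ x²/log x`. The same count works for every `δ > 4/9`
(`A²Q² > x²`, i.e. `1/3 + δ > 1 − δ/2`); for `1/12 < δ ≤ 4/9` nothing cheap is known — the honest
frontier of (a3). -/

/-- `(N^k)^e = N^{k e}` (real powers). -/
theorem rpow_natPow (N k : ℕ) (e : ℝ) : ((((N : ℝ)) ^ k) : ℝ) ^ e = (N : ℝ) ^ ((k : ℝ) * e) := by
  rw [show ((N : ℝ) ^ k : ℝ) = (N : ℝ) ^ ((k : ℕ) : ℝ) by rw [Real.rpow_natCast],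
    ← Real.rpow_mul (Nat.cast_nonneg N)]

/-- `(N^k)^e = N^j` when `k e = j`. -/
theorem natPow_rpow_eq_pow (N k : ℕ) {e : ℝ} {j : ℕ} (h : (k : ℝ) * e = j) :
    ((((N : ℝ)) ^ k) : ℝ) ^ e = (N : ℝ) ^ j := by
  rw [rpow_natPow, h, Real.rpow_natCast]

/-- `N^k / N^j = N^{k−j}` for `j ≤ k`, `N ≠ 0`. -/
theorem natPow_div_natPow (N : ℕ) (hN : N ≠ 0) {j k : ℕ} (hj : j ≤ k) :
    ((N : ℝ)) ^ k / (N : ℝ) ^ j = (N : ℝ) ^ (k - j) := by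
  have hN' : (N : ℝ) ≠ 0 := by exact_mod_cast hN
  rw [div_eq_iff (pow_ne_zero _ hN'), ← pow_add, Nat.sub_add_cancel hj]

/-- With a single column every `S(a,a')² = 1` (`c ≥ 0`): `F = #rows²`. -/
theorem F_of_cols_eq_singleton {c : ℤ} (hc : 0 ≤ c) {x A : ℝ} {q u v : ℕ}
    (h : cols x A q v = {1}) : F c x A q u v = (((rows A q u).card : ℝ)) ^ 2 := by
  unfold F
  have : ∀ a ∈ rows A q u, ∀ a' ∈ rows A q u, (S c x A q v a a') ^ 2 = 1 := by
    intro a ha a' ha'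
    have h1 : (1 : ℤ) ≤ a := by exact_mod_cast one_le_of_mem_rows ha
    have h2 : (1 : ℤ) ≤ a' := by exact_mod_cast one_le_of_mem_rows ha'
    unfold S
    rw [h, Finset.sum_singleton, mul_pow, L_sq_of_pos (by push_cast; linarith),
      L_sq_of_pos (by push_cast; linarith), mul_one]
  rw [Finset.sum_congr rfl fun a ha => Finset.sum_congr rfl fun a' ha' => this a ha a' ha']
  simp; ring

/-- The crux at the single value `δ = 1/2` (everything else unchanged). -/
def AtDeltaHalf : Prop :=
  ∀ c : ℤ, c ≠ 0 → ∀ C : ℝ, 0 < C → ∃ x₀ : ℝ, ∀ x : ℝ, x₀ ≤ x →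
    ∀ A : ℝ, x ^ (1 / 2 : ℝ) ≤ A → A ≤ x ^ (1 / 3 + 1 / 2 : ℝ) → ∀ u v : ℕ → ℕ,
      lhs c (1 / 2) x A u v ≤ x ^ 2 / Real.log x ^ C

/-- (g) `δ = 1/2` is refuted by counting alone. -/
theorem false_at_delta_half : ¬ AtDeltaHalf := by
  intro h
  obtain ⟨x₀, hx₀⟩ := h 1 one_ne_zero 1 one_pos
  obtain ⟨N, hN8, hxN1, -⟩ := exists_scale x₀ 8 (by norm_num)
  have hN1 : 1 ≤ N := by omega
  have hN0 : N ≠ 0 := by omega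
  have hNpos : (0 : ℝ) < N := by exact_mod_cast (by omega : 0 < N)
  have hN1' : (1 : ℝ) ≤ N := by exact_mod_cast hN1
  set x : ℝ := ((N : ℝ)) ^ 12 with hx
  have hxN : x₀ ≤ x := hxN1.trans (le_self_pow₀ hN1' (by norm_num))
  have hA1 : x ^ (1 / 2 : ℝ) ≤ (N : ℝ) ^ 10 := by
    rw [hx, natPow_rpow_eq_pow N 12 (j := 6) (by norm_num)]
    exact pow_le_pow_right₀ hN1' (by norm_num)
  have hA2 : ((N : ℝ)) ^ 10 ≤ x ^ (1 / 3 + 1 / 2 : ℝ) :=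
    (natPow_rpow_eq_pow N 12 (j := 10) (by norm_num)).symm.le
  have key := hx₀ x hxN ((N : ℝ) ^ 10) hA1 hA2 (fun _ => 0) (fun _ => 1)
  have hQ : ⌊x ^ ((1 / 2 : ℝ) / 2)⌋₊ = N ^ 3 := by
    rw [hx, natPow_rpow_eq_pow N 12 (j := 3) (by norm_num), floor_natCast_pow]
  have hfl1 : ⌊((N : ℝ)) ^ 10⌋₊ = N ^ 10 := floor_natCast_pow N 10
  have hfl2 : ⌊2 * ((N : ℝ)) ^ 10⌋₊ = 2 * N ^ 10 := floor_two_mul_natCast_pow N 10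
  have hxA : ⌊x / (N : ℝ) ^ 10⌋₊ = N ^ 2 := by
    rw [hx, natPow_div_natPow N hN0 (by norm_num), floor_natCast_pow]
  -- for N² < q the column class b ≡ 1 (q) is the single column {1}
  have hcols1 : ∀ q : ℕ, N ^ 2 < q → cols x ((N : ℝ) ^ 10) q 1 = {1} := by
    intro q hq
    ext b
    rw [mem_cols, hxA, Finset.mem_singleton]
    constructor
    · rintro ⟨⟨hb1, hb2⟩, hbq⟩
      have hbq' : b % q = 1 % q := hbq
      rw [Nat.mod_eq_of_lt (by omega), Nat.mod_eq_of_lt (by omega)] at hbq'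
      exact hbq'
    · rintro rfl
      exact ⟨⟨le_rfl, Nat.one_le_pow _ _ (by omega)⟩, Nat.ModEq.refl 1⟩
  have hterm : ∀ q : ℕ, q ∈ Finset.Icc (N ^ 2 + 1) (N ^ 3) →
      (N : ℝ) ^ 22 / 4 ≤ (q : ℝ) ^ 3 * F 1 x ((N : ℝ) ^ 10) q 0 1 := by
    intro q hq
    obtain ⟨hq1, hq2⟩ := Finset.mem_Icc.1 hq
    have hqpos : (0 : ℝ) < q := by exact_mod_cast (by omega : 0 < q)
    have hqN2 : (N : ℝ) ^ 2 ≤ q := by exact_mod_cast (by omega : N ^ 2 ≤ q)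
    have hqN3 : (q : ℝ) ≤ (N : ℝ) ^ 3 := by exact_mod_cast hq2
    rw [F_of_cols_eq_singleton (by norm_num) (hcols1 q (by omega))]
    have hrows := (card_rows_bounds ((N : ℝ) ^ 10) (by positivity) q 0 (by omega)).1
    rw [hfl1, hfl2] at hrows
    push_cast at hrows
    have e : ((2 : ℝ) * (N : ℝ) ^ 10 - (N : ℝ) ^ 10) / q = (N : ℝ) ^ 10 / q := by ring
    rw [e] at hrows
    have hbig : (2 : ℝ) ≤ (N : ℝ) ^ 10 / q := by
      rw [le_div_iff₀ hqpos]
      calc (2 : ℝ) * q ≤ 2 * (N : ℝ) ^ 3 := by linarith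
        _ ≤ (N : ℝ) ^ 7 * (N : ℝ) ^ 3 := by
            gcongr
            calc (2 : ℝ) ≤ N := by exact_mod_cast (by omega : 2 ≤ N)
              _ ≤ (N : ℝ) ^ 7 := le_self_pow₀ hN1' (by norm_num)
        _ = (N : ℝ) ^ 10 := by ring
    have hrows' : (N : ℝ) ^ 10 / (2 * q) ≤ ((rows ((N : ℝ) ^ 10) q 0).card : ℝ) := by
      have e2 : (N : ℝ) ^ 10 / (2 * q) = ((N : ℝ) ^ 10 / q) / 2 := by field_simp
      rw [e2]; linarith
    have h0 : (0 : ℝ) ≤ (N : ℝ) ^ 10 / (2 * q) := by positivity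
    calc (N : ℝ) ^ 22 / 4 = (N : ℝ) ^ 2 * ((N : ℝ) ^ 20 / 4) := by ring
      _ ≤ (q : ℝ) * ((N : ℝ) ^ 20 / 4) := by gcongr
      _ = (q : ℝ) ^ 3 * ((N : ℝ) ^ 10 / (2 * q)) ^ 2 := by field_simp; ring
      _ ≤ (q : ℝ) ^ 3 * (((rows ((N : ℝ) ^ 10) q 0).card : ℝ)) ^ 2 := by gcongr
  have hsub : Finset.Icc (N ^ 2 + 1) (N ^ 3) ⊆ Finset.Icc 1 (N ^ 3) :=
    Finset.Icc_subset_Icc (by omega) le_rfl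
  have hcard : ((N : ℝ)) ^ 3 / 2 ≤ ((Finset.Icc (N ^ 2 + 1) (N ^ 3)).card : ℝ) := by
    rw [Nat.card_Icc]
    have h23 : N ^ 2 ≤ N ^ 3 := Nat.pow_le_pow_right (by omega) (by norm_num)
    have : ((N ^ 3 + 1 - (N ^ 2 + 1) : ℕ) : ℝ) = (N : ℝ) ^ 3 - (N : ℝ) ^ 2 := by
      rw [show N ^ 3 + 1 - (N ^ 2 + 1) = N ^ 3 - N ^ 2 by omega]; push_cast [Nat.cast_sub h23]; ring
    rw [this]
    have : (2 : ℝ) * (N : ℝ) ^ 2 ≤ (N : ℝ) ^ 3 := by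
      calc (2 : ℝ) * (N : ℝ) ^ 2 ≤ N * (N : ℝ) ^ 2 := by gcongr; exact_mod_cast (by omega : 2 ≤ N)
        _ = (N : ℝ) ^ 3 := by ring
    linarith
  have hlow : (N : ℝ) ^ 25 / 8 ≤ lhs 1 (1 / 2) x ((N : ℝ) ^ 10) (fun _ => 0) (fun _ => 1) := by
    unfold lhs
    rw [hQ]
    calc (N : ℝ) ^ 25 / 8 = ((N : ℝ) ^ 3 / 2) * ((N : ℝ) ^ 22 / 4) := by ring
      _ ≤ ((Finset.Icc (N ^ 2 + 1) (N ^ 3)).card : ℝ) * ((N : ℝ) ^ 22 / 4) := by gcongr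
      _ = ∑ q ∈ Finset.Icc (N ^ 2 + 1) (N ^ 3), (N : ℝ) ^ 22 / 4 := by
          rw [Finset.sum_const, nsmul_eq_mul]
      _ ≤ ∑ q ∈ Finset.Icc (N ^ 2 + 1) (N ^ 3), (q : ℝ) ^ 3 * F 1 x ((N : ℝ) ^ 10) q 0 1 :=
          Finset.sum_le_sum hterm
      _ ≤ ∑ q ∈ Finset.Icc 1 (N ^ 3), (q : ℝ) ^ 3 * F 1 x ((N : ℝ) ^ 10) q 0 1 :=
          Finset.sum_le_sum_of_subset_of_nonneg hsub fun q _ _ => term_nonneg 1 x _ q 0 1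
  -- right-hand side: x²/log x = N²⁴/(12 log N) < N²⁴ ≤ N²⁵/8
  have hlogN : 2 < Real.log N := by
    have h8 : (8 : ℝ) ≤ N := by exact_mod_cast hN8
    exact lt_of_lt_of_le (by
      rw [Real.lt_log_iff_exp_lt (by norm_num)]
      have he := Real.exp_one_lt_d9
      have : Real.exp 2 = Real.exp 1 * Real.exp 1 := by rw [← Real.exp_add]; norm_num
      rw [this]; nlinarith [Real.exp_pos 1]) (Real.log_le_log (by norm_num) h8)
  have hrhs : x ^ 2 / Real.log x ^ (1 : ℝ) < (N : ℝ) ^ 25 / 8 := by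
    rw [Real.rpow_one, hx, ← pow_mul, Real.log_pow]
    push_cast
    have hpos : (0 : ℝ) < (N : ℝ) ^ 24 := by positivity
    calc ((N : ℝ)) ^ (12 * 2) / (12 * Real.log N) < (N : ℝ) ^ 24 / 1 := by
          rw [show 12 * 2 = 24 by norm_num]
          exact div_lt_div_of_pos_left hpos one_pos (by linarith)
      _ = (N : ℝ) ^ 24 := div_one _
      _ ≤ (N : ℝ) ^ 25 / 8 := by
          rw [le_div_iff₀ (by norm_num)]
          calc (N : ℝ) ^ 24 * 8 ≤ (N : ℝ) ^ 24 * N := by gcongr; exact_mod_cast hN8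
            _ = (N : ℝ) ^ 25 := by ring
  linarith

end Summit.Parity.GeneralizedHardyLittlewood.Theorems.DilatedTableChowla.Negative
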